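import Literature.NumberTheory.Automorphic.ArchEndoscopicChartOrbPlaces           -- ★ p850200∕p850227 (LH3-p03 (g3)): (P4) `chartOrbHLoc_eq_integral_of_not_mem`, `endoBlockAt`
import Literature.NumberTheory.Automorphic.ArchLocalTorusOrbitalContinuity        -- ★ diagonal-frame kit: `hasCompactSupport_comp_conj_circleDiagonal`, `continuousOn_integral_comp_conj_circleDiagonal`
import Literature.NumberTheory.Automorphic.UnitaryGroupFormTransport              -- ★ `unitaryGroupOfFormCongrOfEq` (change of frame `g ↦ T g T⁻¹`)
import Literature.NumberTheory.Automorphic.ArchEndoscopicChartOrbitalContinuity     -- ★ p849873 (F0P3a-p09 (g5)): `formCongr_cayleyTwo_eq_map_diagonal`, `isCompact_setOf_exists_conj_endoBlock_mem_of_not_mem`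
import HarnessLib

/-!
# The local chart orbital functional at a COMPACT place: compact support of the orbital integrand and continuity at regular elliptic chart points — (P-cont-c)
# (Rogawski 1990 §8.2–8.3; Shelstad 1979 §4; Harish-Chandra: `Φ(γ, f)` is smooth on `T_reg`)

Topic `NumberTheory/Automorphic`; namespace `Literature.NumberTheory.Automorphic.UnitaryGroup`.  THEOREMS ONLY (no definition, no instance, no notation, no axiom, no named
fact, no `sorry`).  Cell `pub/hodgecm-mathlib`, line LH3 (closer stub `stub_N9`, crux H413 = `stmt-HodgeConjecture-24833`); brick **(P-cont-c) «spectator continuity + closed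
orbit at a compact place»** (LH10-p02 (g4) 2026-09-02T07:55:32Z (ii), taken by LH5-p04 (g2) 08:00Z): the two BY-STATEMENT spectator binders `hsupp` ∕ `hcontC` of ★ (N3)
`stOrbFamH_insert_cayPt_ne_zero_of_prodData` (p850341) and of ★ (J-H) `…JumpZeroProduct` §4 (p850334) at a COMPACT place `w ∉ S`.  Author LH5-p04 (g2).  Lane `--kind proof
--supports stmt-HodgeConjecture-24833` (count-neutral).

THE MATHEMATICS.  At a compact place `w ∉ S` the chart point is the Cayley-frame circle element `endoBlockAt S w cw = P · diag(e^{i cw₀}, e^{i cw₂}) · P⁻¹ ∈ U(Φ₂)_w`,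
`P = (1 1; 1 −1)`, `P̄ᵀ Φ₂ P = diag(2, −2)` (★ `formCongr_cayleyTwo`).  Conjugation by `P` is an isomorphism of topological groups
`E : U(diag(2,−2))_w ≃ₜ* U(Φ₂)_w` (★ `unitaryGroupOfFormCongrOfEq`) with `E(diag z) = endoBlockAt S w cw`, `z = (e^{i cw₀}, e^{i cw₂})`; the point is REGULAR iff `z` is injective
(`e^{i cw₀} ≠ e^{i cw₂}`).  Transporting the diagonal-frame kit ★ `ArchLocalTorusOrbitalContinuity` along `E`:
* §2 **`hasCompactSupport_comp_conj_endoBlockAt_of_not_mem`** — for `f ∈ C_c(U(Φ₂)_w)` and a regular compact chart point, `h ↦ f(h · endoBlockAt S w cw · h⁻¹)` has compact support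
  (the orbit of a regular elliptic element is closed and its centraliser compact); hence **`hasCompactSupport_descConj_endoBlockAt_of_not_mem`** on `U(Φ₂)_w ⧸ T_{S,w}` = the
  `hsupp` binder.
* §3 **`continuousAt_chartOrbHLoc_of_not_mem`** — for a Haar `ν_w` and `f ∈ C_c(U(Φ₂)_w, ℂ)`, `cw ↦ chartOrbHLoc L S w ν_w f cw` is continuous at every regular compact local triple
  (★ (P4) `chartOrbHLoc_eq_integral_of_not_mem`: whole-group integral; change of variables along `E`; ★ `continuousOn_integral_comp_conj_circleDiagonal`) = the `hcontC` binder (apply it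
  at `cw` and at `cw^flip`, both regular).
HONEST LABEL: HC_CM is proved only modulo the 7 printed citations (2 remaining: hLiu418 = stmt-HodgeConjecture-24832, h413 = stmt-HodgeConjecture-24833) until rung 0 closes;
frame transport, pays nothing by itself.

## References
* [Rogawski1990] J. D. Rogawski, *Automorphic Representations of Unitary Groups in Three Variables*, Ann. of Math. Stud. 123 (1990), §8.2 p. 122, §8.3 pp. 122–124, §3.1 p. 19.
* [Shelstad1979] D. Shelstad, *Characters and inner forms of a quasi-split group over ℝ*, Compositio Math. 39 (1979) 11–45, §4 pp. 22–25.
* [DeitmarEchterhoff2014] A. Deitmar, S. Echterhoff, *Principles of Harmonic Analysis*, 2nd ed., Lemma 9.3.3.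
* [PlatonovRapinchuk1994] V. Platonov, A. Rapinchuk, *Algebraic Groups and Number Theory* (1994), §2.3 (change of frame for unitary groups).
-/

set_option autoImplicit false

noncomputable section

open MeasureTheory MeasureTheory.Measure NumberField NumberField.InfinitePlace Matrix Complex Topology Filter Set Function
open Literature.MeasureTheory.Group
open scoped MatrixGroups Matrix ComplexConjugate

namespace Literature.NumberTheory.Automorphic.UnitaryGroup

/-! ## §1 The chart point at a compact place is the Cayley image of the circle element (frame ★ `formCongr_cayleyTwo_eq_map_diagonal`) -/

section Frame

variable (L : Type) [Field L] [NumberField L] (w : {w : InfinitePlace L // IsComplex w})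

/-- **AT A COMPACT PLACE THE CHART POINT IS THE CAYLEY IMAGE OF THE CIRCLE ELEMENT**: `endoBlockAt S w cw = E (diag(e^{i cw₀}, e^{i cw₂}))`, `E g = P g P⁻¹`.
[cite: Rogawski1990, §8.2 p. 122] -/
theorem endoBlockAt_eq_cayleyCongr_circleDiagonal (S : Finset {w : InfinitePlace L // IsComplex w}) (hw : w ∉ S) (cw : Fin 3 → ℝ) :
    endoBlockAt L S w cw =
      (unitaryGroupOfFormCongrOfEq (starRingEnd ℂ) (Matrix.GeneralLinearGroup.mkOfDetNeZero !![(1 : ℂ), 1; 1, -1] det_cayleyTwo_ne_zero)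
        ((Matrix.of fun i j : Fin 2 => if i.val + j.val + 1 = 2 then (1 : L) else 0).map w.1.embedding) ((Matrix.diagonal ![(2 : L), -2]).map w.1.embedding)
        (formCongr_cayleyTwo_eq_map_diagonal L w) :
        ↥(archLocal L 2 (Matrix.diagonal ![(2 : L), -2]) w) ≃ₜ* ↥(archLocal L 2 (Matrix.of fun i j : Fin 2 => if i.val + j.val + 1 = 2 then (1 : L) else 0) w))
        ⟨circleDiagonal 2 ![Circle.exp (cw 0), Circle.exp (cw 2)], circleDiagonal_mem_archLocal_diagonal L 2 ![(2 : L), -2] w _⟩ := by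
  apply Subtype.ext
  change ((endoBlock L S (fun _ => cw) w : ↥(archLocal L 2 (Matrix.of fun i j : Fin 2 => if i.val + j.val + 1 = 2 then (1 : L) else 0) w)) : GL (Fin 2) ℂ) =
    Matrix.GeneralLinearGroup.mkOfDetNeZero !![(1 : ℂ), 1; 1, -1] det_cayleyTwo_ne_zero * circleDiagonal 2 ![Circle.exp (cw 0), Circle.exp (cw 2)] *
      (Matrix.GeneralLinearGroup.mkOfDetNeZero !![(1 : ℂ), 1; 1, -1] det_cayleyTwo_ne_zero)⁻¹
  unfold endoBlock
  rw [if_neg hw]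

end Frame

/-! ## §2 Compact support of the orbital integrand at a regular compact chart point -/

section Support

variable (L : Type) [Field L] [NumberField L] (S : Finset {w : InfinitePlace L // IsComplex w}) (w : {w : InfinitePlace L // IsComplex w})

omit [NumberField L] in
/-- `(e^{i a}, e^{i b})` is an injective pair iff `e^{i a} ≠ e^{i b}`. [cite: Shelstad1979, §4 p. 22] -/
theorem injective_vecCons_circleExp_iff (a b : ℝ) : Function.Injective ![Circle.exp a, Circle.exp b] ↔ Circle.exp a ≠ Circle.exp b := by
  constructor
  · intro h hab
    have : (0 : Fin 2) = 1 := h (by simpa using hab)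
    exact absurd this (by decide)
  · intro hab i j hij
    fin_cases i <;> fin_cases j
    · rfl
    · exact absurd (by simpa using hij) hab
    · exact absurd (by simpa using hij.symm) hab
    · rfl

/-- **THE ORBITAL INTEGRAND AT A REGULAR COMPACT CHART POINT HAS COMPACT SUPPORT** (group level): for `w ∉ S`, `e^{i cw₀} ≠ e^{i cw₂}` and `f` compactly supported on `U(Φ₂)_w`,
`h ↦ f(h · endoBlockAt S w cw · h⁻¹)` has compact support — its support lies in the compact conjugating set of ★ `isCompact_setOf_exists_conj_endoBlock_mem_of_not_mem`
(Harish-Chandra at a compact place, `K = {cw}`, `C = tsupport f`). [cite: Rogawski1990, §8.3 p. 122] [cite: DeitmarEchterhoff2014, Lemma 9.3.3] -/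
theorem hasCompactSupport_comp_conj_endoBlockAt_of_not_mem (hw : w ∉ S) {cw : Fin 3 → ℝ} (hreg : Circle.exp (cw 0) ≠ Circle.exp (cw 2))
    {E' : Type*} [Zero E'] (f : ↥(archLocal L 2 (Matrix.of fun i j : Fin 2 => if i.val + j.val + 1 = 2 then (1 : L) else 0) w) → E') (hfc : HasCompactSupport f) :
    HasCompactSupport fun h : ↥(archLocal L 2 (Matrix.of fun i j : Fin 2 => if i.val + j.val + 1 = 2 then (1 : L) else 0) w) => f (h * endoBlockAt L S w cw * h⁻¹) := by
  -- the conjugating set into `tsupport f` is compact (★ Harish-Chandra at a compact place, Cayley frame)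
  have hK := isCompact_setOf_exists_conj_endoBlock_mem_of_not_mem L w S hw
    (K := {fun _ : {w : InfinitePlace L // IsComplex w} => cw}) isCompact_singleton
    (fun c hc => by rw [Set.mem_singleton_iff.1 hc]; exact hreg) hfc.isCompact
  refine HasCompactSupport.intro hK fun y hy => ?_
  refine image_eq_zero_of_notMem_tsupport fun h => hy ⟨fun _ => cw, rfl, ?_⟩
  rw [endoBlock_eq_endoBlockAt]
  exact h

/-- **THE ORBITAL INTEGRAND ON `U(Φ₂)_w ⧸ T_{S,w}` AT A REGULAR COMPACT CHART POINT HAS COMPACT SUPPORT** — the `hsupp` binder of ★ (N3) `stOrbFamH_insert_cayPt_ne_zero_of_prodData` and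
of ★ (N2a) at a compact spectator place. [cite: Rogawski1990, §8.3 p. 122] [cite: DeitmarEchterhoff2014, Lemma 9.3.3] -/
theorem hasCompactSupport_descConj_endoBlockAt_of_not_mem (hw : w ∉ S) {cw : Fin 3 → ℝ} (hreg : Circle.exp (cw 0) ≠ Circle.exp (cw 2))
    {E' : Type*} [Zero E'] [TopologicalSpace E']
    (f : ↥(archLocal L 2 (Matrix.of fun i j : Fin 2 => if i.val + j.val + 1 = 2 then (1 : L) else 0) w) → E') (hfc : HasCompactSupport f) :
    HasCompactSupport (descConj (endoBlockAt L S w cw) (chartTorusHLoc L S w) (forall_mem_chartTorusHLoc_comm L S w cw) f) := by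
  haveI : IsClosed ((chartTorusHLoc L S w : Subgroup ↥(archLocal L 2 (Matrix.of fun i j : Fin 2 => if i.val + j.val + 1 = 2 then (1 : L) else 0) w)) :
      Set ↥(archLocal L 2 (Matrix.of fun i j : Fin 2 => if i.val + j.val + 1 = 2 then (1 : L) else 0) w)) := isClosed_chartTorusHLoc L S w
  have hK := (hasCompactSupport_comp_conj_endoBlockAt_of_not_mem L S w hw hreg f hfc).isCompact
  refine HasCompactSupport.intro (hK.image (QuotientGroup.continuous_mk)) fun y hy => ?_
  induction y using QuotientGroup.induction_on with
  | H g =>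
    rw [descConj_mk]
    exact image_eq_zero_of_notMem_tsupport
      (f := fun h : ↥(archLocal L 2 (Matrix.of fun i j : Fin 2 => if i.val + j.val + 1 = 2 then (1 : L) else 0) w) => f (h * endoBlockAt L S w cw * h⁻¹))
      fun hg => hy ⟨g, hg, rfl⟩

end Support

/-! ## §3 Continuity of the local chart functional at regular compact local triples -/

section ContinuityAt

variable (L : Type) [Field L] [NumberField L] [IsCMField L] (S : Finset {w : InfinitePlace L // IsComplex w}) (w : {w : InfinitePlace L // IsComplex w})
  [MeasurableSpace ↥(archLocal L 2 (Matrix.of fun i j : Fin 2 => if i.val + j.val + 1 = 2 then (1 : L) else 0) w)]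
  [BorelSpace ↥(archLocal L 2 (Matrix.of fun i j : Fin 2 => if i.val + j.val + 1 = 2 then (1 : L) else 0) w)]
  (νw : Measure ↥(archLocal L 2 (Matrix.of fun i j : Fin 2 => if i.val + j.val + 1 = 2 then (1 : L) else 0) w)) [νw.IsHaarMeasure] [νw.IsMulRightInvariant]

omit [IsCMField L] [νw.IsMulRightInvariant] in
/-- **THE WHOLE-GROUP ORBITAL INTEGRAL OF `U(Φ₂)_w` IS CONTINUOUS AT REGULAR ELLIPTIC CHART POINTS**: for `w ∉ S`, a Haar `ν_w` and `f ∈ C_c(U(Φ₂)_w, ℂ)`,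
`cw ↦ ∫_{U(Φ₂)_w} f(h · endoBlockAt S w cw · h⁻¹) dν_w` is continuous at every `cw` with `e^{i cw₀} ≠ e^{i cw₂}` — ★ `continuousOn_integral_comp_conj_circleDiagonal` transported along
the Cayley equivalence (change of variables `ν_w ↦ E⁻¹_* ν_w`). [cite: Rogawski1990, §8.3 p. 122] [cite: Shelstad1979, §4 p. 22] -/
theorem continuousAt_integral_comp_conj_endoBlockAt_of_not_mem (hw : w ∉ S) {cw : Fin 3 → ℝ} (hreg : Circle.exp (cw 0) ≠ Circle.exp (cw 2))
    (f : ↥(archLocal L 2 (Matrix.of fun i j : Fin 2 => if i.val + j.val + 1 = 2 then (1 : L) else 0) w) → ℂ) (hf : Continuous f) (hfc : HasCompactSupport f) :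
    ContinuousAt (fun c : Fin 3 → ℝ => ∫ h, f (h * endoBlockAt L S w c * h⁻¹) ∂νw) cw := by
  set E : ↥(archLocal L 2 (Matrix.diagonal ![(2 : L), -2]) w) ≃ₜ* ↥(archLocal L 2 (Matrix.of fun i j : Fin 2 => if i.val + j.val + 1 = 2 then (1 : L) else 0) w) :=
    unitaryGroupOfFormCongrOfEq (starRingEnd ℂ) (Matrix.GeneralLinearGroup.mkOfDetNeZero !![(1 : ℂ), 1; 1, -1] det_cayleyTwo_ne_zero)
        ((Matrix.of fun i j : Fin 2 => if i.val + j.val + 1 = 2 then (1 : L) else 0).map w.1.embedding) ((Matrix.diagonal ![(2 : L), -2]).map w.1.embedding)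
        (formCongr_cayleyTwo_eq_map_diagonal L w) with hE
  letI : MeasurableSpace ↥(archLocal L 2 (Matrix.diagonal ![(2 : L), -2]) w) := borel _
  haveI : BorelSpace ↥(archLocal L 2 (Matrix.diagonal ![(2 : L), -2]) w) := ⟨rfl⟩
  set e : ↥(archLocal L 2 (Matrix.diagonal ![(2 : L), -2]) w) ≃ᵐ ↥(archLocal L 2 (Matrix.of fun i j : Fin 2 => if i.val + j.val + 1 = 2 then (1 : L) else 0) w) :=
    E.toHomeomorph.toMeasurableEquiv with he
  haveI : IsFiniteMeasureOnCompacts (νw.map e.symm) := by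
    have h := IsFiniteMeasureOnCompacts.map νw E.toHomeomorph.symm
    rw [← Homeomorph.toMeasurableEquiv_symm_coe] at h
    exact h
  have hα : ∀ i, (![(2 : L), -2] : Fin 2 → L) i ≠ 0 := by
    intro i
    fin_cases i
    · simp
    · simp
  -- the coordinate-to-circle map and its regular set
  have hzc : Continuous fun c : Fin 3 → ℝ => (![Circle.exp (c 0), Circle.exp (c 2)] : Fin 2 → Circle) := by
    refine continuous_pi fun i => ?_
    fin_cases i
    · exact Circle.exp.continuous.comp (continuous_apply 0)
    · exact Circle.exp.continuous.comp (continuous_apply 2)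
  have hU : IsOpen {c : Fin 3 → ℝ | Circle.exp (c 0) ≠ Circle.exp (c 2)} :=
    isOpen_ne_fun (Circle.exp.continuous.comp (continuous_apply 0)) (Circle.exp.continuous.comp (continuous_apply 2))
  -- change of variables along `E`, for every `c`
  have hcov : ∀ c : Fin 3 → ℝ, ∫ h, f (h * endoBlockAt L S w c * h⁻¹) ∂νw =
      ∫ h', (f ∘ E) (h' * ⟨circleDiagonal 2 ![Circle.exp (c 0), Circle.exp (c 2)], circleDiagonal_mem_archLocal_diagonal L 2 ![(2 : L), -2] w _⟩ * h'⁻¹) ∂(νw.map e.symm) := by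
    intro c
    rw [integral_map_equiv]
    refine integral_congr_ae (Eventually.of_forall fun x => ?_)
    show f (x * endoBlockAt L S w c * x⁻¹) =
      f (E (E.symm x * ⟨circleDiagonal 2 ![Circle.exp (c 0), Circle.exp (c 2)], circleDiagonal_mem_archLocal_diagonal L 2 ![(2 : L), -2] w _⟩ * (E.symm x)⁻¹))
    rw [map_mul, map_mul, map_inv, ContinuousMulEquiv.apply_symm_apply, endoBlockAt_eq_cayleyCongr_circleDiagonal L w S hw c]
    rfl
  -- continuity on the regular set
  have hD := continuousOn_integral_comp_conj_circleDiagonal L 2 ![(2 : L), -2] w hα (νw.map e.symm) (f ∘ E) (hf.comp E.continuous)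
    (hfc.comp_homeomorph E.toHomeomorph)
  have hcomp : ContinuousOn (fun c : Fin 3 → ℝ => ∫ h, f (h * endoBlockAt L S w c * h⁻¹) ∂νw) {c : Fin 3 → ℝ | Circle.exp (c 0) ≠ Circle.exp (c 2)} := by
    have h := hD.comp hzc.continuousOn fun c hc => (injective_vecCons_circleExp_iff (c 0) (c 2)).2 hc
    refine h.congr fun c _ => ?_
    exact hcov c
  exact hcomp.continuousAt (hU.mem_nhds hreg)

/-- **(P-cont-c) THE LOCAL CHART FUNCTIONAL IS CONTINUOUS AT REGULAR COMPACT LOCAL TRIPLES** — the `hcontC` binder of ★ (N3) `stOrbFamH_insert_cayPt_ne_zero_of_prodData` and of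
★ (J-H) `…JumpZeroProduct` §4 (apply it at `cw` and at `cw^flip = ![cw 2, cw 1, cw 0]`, both regular): for `w ∉ S`, a Haar `ν_w` and `f ∈ C_c(U(Φ₂)_w, ℂ)`,
`ContinuousAt (chartOrbHLoc L S w ν_w f) cw` whenever `e^{i cw₀} ≠ e^{i cw₂}` (★ (P4): at a compact place the functional IS the whole-group orbital integral).
[cite: Rogawski1990, §8.2 p. 122; §8.3 p. 124] [cite: Shelstad1979, §4 p. 22] -/
theorem continuousAt_chartOrbHLoc_of_not_mem (hw : w ∉ S) {cw : Fin 3 → ℝ} (hreg : Circle.exp (cw 0) ≠ Circle.exp (cw 2))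
    (f : ↥(archLocal L 2 (Matrix.of fun i j : Fin 2 => if i.val + j.val + 1 = 2 then (1 : L) else 0) w) → ℂ) (hf : Continuous f) (hfc : HasCompactSupport f) :
    ContinuousAt (chartOrbHLoc L S w νw f) cw := by
  have heq : chartOrbHLoc L S w νw f = fun c : Fin 3 → ℝ => ∫ h, f (h * endoBlockAt L S w c * h⁻¹) ∂νw :=
    funext fun c => chartOrbHLoc_eq_integral_of_not_mem L S w νw hw f hf.measurable c
  rw [heq]
  exact continuousAt_integral_comp_conj_endoBlockAt_of_not_mem L S w νw hw hreg f hf hfc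

/-- The flipped triple of a regular compact triple is regular, and the functional is continuous there too (the second `hcontC` conjunct).
[cite: Shelstad1979, §4 p. 23] -/
theorem continuousAt_chartOrbHLoc_flip_of_not_mem (hw : w ∉ S) {cw : Fin 3 → ℝ} (hreg : Circle.exp (cw 0) ≠ Circle.exp (cw 2))
    (f : ↥(archLocal L 2 (Matrix.of fun i j : Fin 2 => if i.val + j.val + 1 = 2 then (1 : L) else 0) w) → ℂ) (hf : Continuous f) (hfc : HasCompactSupport f) :
    ContinuousAt (chartOrbHLoc L S w νw f) ![cw 2, cw 1, cw 0] :=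
  continuousAt_chartOrbHLoc_of_not_mem L S w νw hw (cw := ![cw 2, cw 1, cw 0]) (by simpa using hreg.symm) f hf hfc

end ContinuityAt

end Literature.NumberTheory.Automorphic.UnitaryGroup

end
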